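import Summits.ResolutionOfSingularities.ResolutionOfSingularities.Theorems.MarkedTransferCampaignW12SandwichA1Cells
import Literature.RingTheory.MvPowerSeries.MaximalIdealPow
import Literature.RingTheory.TwoVariableSeries.Basic
import Mathlib.RingTheory.MvPowerSeries.Basic
import Mathlib.RingTheory.MvPowerSeries.Order
import HarnessLib

/-!
# [OURS · L1 G1 ℘nega-INTERFACE · K14-2 datum] The COMPLETION datum of record `K[x] → K⟦x⟧` for the F4 column
# (`baseChange_mem` / `baseChange_le`): the sandwich calibrated on `K⟦x⟧`, and F4 × SW / PW = ✓ at this datum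

LADDER-RESOLUTION rung L (rescue), cell `res-hironaka`, group G1 (`℘nega`). D-lane draft by res-D-pv-040 (HOME/D/res-D-pv-040/;
KEEP seat «℘nega G1 cells + SW calibration for the 08:00Z table», res-D-plan-1 CONVERSION LIST 2026-08-27T04:18:54Z; OFFER K14-2
04:22:17Z). Companion of `MarkedTransferCampaignW12SandwichA1Calibration.lean` (p493564): the interface field F4 quantifies over a
provenance predicate `prov.IsCompletion φ P P'` for which no datum is typed (res-D-plan-1 ROUTING #14 (c) K14-1 asks the same for F1's
`prov.IsChart`); this file supplies the DATA-LEVEL completion datum `φ : K[x] = MvPolynomial (Fin 1) K → K⟦x⟧ = MvPowerSeries (Fin 1) K`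
(Mathlib `MvPolynomial.coeToMvPowerSeries.ringHom`), `P j = (x)^j`, `P' j = 𝔪′^j`, class regime `m = p^e`, and DECIDES F4 there:
the `K⟦x⟧`-side calibration `℘nega_sw′(−a) = 𝔪′^{k(a)·p^e}` (`sandwichPNega_powerSeriesLine_eq`, same mechanism as PART 1:
`x^{dp^e} = ρ^e(x^d)` generates `𝔪′^{dp^e}` and no relative operator leaves a Frobenius span — tree
`Campaign.W12.sandwichPNega_le_span_of_range`) gives BOTH printed inclusions for SW (`F4_baseChange_mem_sandwich_affineLine`,
`F4_baseChange_le_sandwich_affineLine`) and for the power witness PW (`…_powerWitness_…`): F4 = ✓ at this datum, for all four rows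
(V0 ✓ content-free by collapse; SWρ ≡ SW as sets, res-type-048 p495165) — i.e. the F4 column does NOT discriminate at the placement of
record. NO new definition; the instance binder `[CharP K⟦x⟧ p]` is dischargeable (`Literature.RingTheory.TwoVariableSeries.charP_mvPowerSeries`).

CARRIER NOTE (res-L1-type-o2 g6): KERNEL by res-D-pv-040 (HOME draft `D/res-D-pv-040/PnegaSandwichF4Completion.draft.lean` sha16 c2cbae4fc1e4f3fd, DELIVERED #5 2026-08-27T04:29:50Z; res-adj-1 DECISION 04:29:16Z (c) K14-2 GO-IF-IDLE), carried summit-side VERBATIM (this note added). [OURS · L1 G1] replaces the role of: nothing printed — a typed F4 (completion base change) provenance datum for the W1.2 sandwich / PW at the affine line; NOT a statement of the manuscript.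
HONEST FRAMING. Nothing here is a statement of H. Hironaka's manuscript *Resolution of singularities in positive characteristics*
(2017-03-23, [Hironaka2017], lit key `paper:url-3343fd9e678b`); Def 5.1 and the F4 demand («K⟦s⟧ faithfully flat over O_ξ», p.31
l.48–50; p.38 l.20–23) enter only as SHAPES re-based on `ρ^e(O)` (OURS rescue candidates), CANDIDATES [claim: Hironaka2017, status:
under-review]. AI typing/proving is weaker than expert review; nothing here is progress on resolution of singularities in positive
characteristic; no claim beyond the kernel.
-/

noncomputable section

set_option linter.dupNamespace false -- mandated namespace of this single-conjunct summit

namespace Summit.ResolutionOfSingularities.ResolutionOfSingularities.Theorems.Campaign.W12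

open MvPolynomial
open Literature.AlgebraicGeometry.Resolution
open Literature.AlgebraicGeometry.Hironaka2017
open Summit.ResolutionOfSingularities.ResolutionOfSingularities.Theorems.Campaign
open Literature.RingTheory.MvPowerSeries.Jets

universe u

/-! ## §1 The least admissible summand index `k(a) = max(1, ⌈a/q⌉)` of Eq. (36) -/

/-- For `q ≥ 1` and every `a` there is a least `k ≥ 1` with `a ≤ k·q`. [folklore] -/
theorem exists_least_admissible (q : ℕ) (hq : 0 < q) (a : ℕ) :
    ∃ k : ℕ, 0 < k ∧ a ≤ k * q ∧ ∀ d : ℕ, 0 < d → a ≤ d * q → k ≤ d := by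
  classical
  have hex : ∃ k : ℕ, 0 < k ∧ a ≤ k * q := ⟨a + 1, Nat.succ_pos a, by nlinarith⟩
  refine ⟨Nat.find hex, (Nat.find_spec hex).1, (Nat.find_spec hex).2, fun d hd had => ?_⟩
  exact Nat.find_min' hex ⟨hd, had⟩

/-! ## §2 The `K⟦x⟧`-side placement: `MvPowerSeries (Fin 1) K`, `P′ j = 𝔪′^j` -/

section PowerSeriesLine

variable (K : Type u) [Field K] (p : ℕ) [Fact p.Prime] [CharP K p]

/-- `x^j ∈ 𝔪′^n ↔ n ≤ j` in `K⟦x⟧`. [folklore] -/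
theorem psX_pow_mem_maximalIdeal_pow_iff (n j : ℕ) :
    (MvPowerSeries.X 0 : MvPowerSeries (Fin 1) K) ^ j ∈ IsLocalRing.maximalIdeal (MvPowerSeries (Fin 1) K) ^ n ↔ n ≤ j := by
  rw [MvPowerSeries.X_pow_eq]
  constructor
  · intro h
    have := le_order_of_mem_maximalIdeal_pow h
    rw [MvPowerSeries.order_monomial_of_ne_zero (one_ne_zero' K), Finsupp.degree_single] at this
    exact_mod_cast this
  · intro h
    exact monomial_mem_maximalIdeal_pow (by rw [Finsupp.degree_single]; exact h) 1

/-- `𝔪′^n = (x^n)` in `K⟦x⟧`. [folklore] -/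
theorem maximalIdeal_pow_eq_span_psX_pow (n : ℕ) :
    IsLocalRing.maximalIdeal (MvPowerSeries (Fin 1) K) ^ n =
      Ideal.span {(MvPowerSeries.X 0 : MvPowerSeries (Fin 1) K) ^ n} := by
  apply le_antisymm
  · rw [maximalIdeal_pow_eq_span_monomial, Ideal.span_le]
    rintro _ ⟨e, he, rfl⟩
    have he' : Finsupp.degree e = n := he
    have hdeg : e default = n := by
      rw [Finsupp.unique_single e, Finsupp.degree_single] at he'
      exact he'
    have hee : e = Finsupp.single 0 n := by
      rw [Finsupp.unique_single e, hdeg]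
      rfl
    show MvPowerSeries.monomial e (1 : K) ∈ Ideal.span {(MvPowerSeries.X 0 : MvPowerSeries (Fin 1) K) ^ n}
    rw [hee, ← MvPowerSeries.X_pow_eq]
    exact Ideal.subset_span rfl
  · rw [Ideal.span_le, Set.singleton_subset_iff]
    exact (psX_pow_mem_maximalIdeal_pow_iff K n n).mpr le_rfl

omit [CharP K p] in
/-- **Upper calibration on `K⟦x⟧`** (`P′ j = 𝔪′^j`, `m = p^e`): if every admissible `d ≥ 1` with `a ≤ d·p^e` is `≥ k`, then
`℘nega_sw′(E,−a) ⊆ 𝔪′^{k·p^e}` (tree `Campaign.W12.sandwichPNega_le_span_of_range`; `x^{kp^e} = ρ^e(x^k)`). [folklore] -/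
theorem sandwichPNega_powerSeriesLine_le [CharP (MvPowerSeries (Fin 1) K) p] (e a k : ℕ)
    (hmin : ∀ d : ℕ, 0 < d → a ≤ d * p ^ e → k ≤ d) :
    sandwichPNega p e (fun j => IsLocalRing.maximalIdeal (MvPowerSeries (Fin 1) K) ^ j) (p ^ e) a ≤
      IsLocalRing.maximalIdeal (MvPowerSeries (Fin 1) K) ^ (k * p ^ e) := by
  rw [maximalIdeal_pow_eq_span_psX_pow]
  refine sandwichPNega_le_span_of_range p e ?_ ?_
  · rintro _ ⟨⟩
    exact ⟨MvPowerSeries.X 0 ^ k, by rw [iterateFrobenius_def, ← pow_mul]⟩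
  · intro d hd had
    have hdm : d * p ^ e ≠ 0 := Nat.mul_ne_zero hd.ne' (pow_prime_ne_zero p e)
    simp only [S05NegativePart.pPosi, if_neg hdm]
    rw [← maximalIdeal_pow_eq_span_psX_pow]
    exact Ideal.pow_le_pow_right (Nat.mul_le_mul_right _ (hmin d hd had))

omit [CharP K p] in
/-- **THE CALIBRATION on `K⟦x⟧`:** `℘nega_sw′(E,−a) = 𝔪′^{k·p^e}`, `k` the least admissible summand index. [folklore] -/
theorem sandwichPNega_powerSeriesLine_eq [CharP (MvPowerSeries (Fin 1) K) p] (e a k : ℕ) (hk : 0 < k) (ha : a ≤ k * p ^ e)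
    (hmin : ∀ d : ℕ, 0 < d → a ≤ d * p ^ e → k ≤ d) :
    sandwichPNega p e (fun j => IsLocalRing.maximalIdeal (MvPowerSeries (Fin 1) K) ^ j) (p ^ e) a =
      IsLocalRing.maximalIdeal (MvPowerSeries (Fin 1) K) ^ (k * p ^ e) :=
  le_antisymm (sandwichPNega_powerSeriesLine_le K p e a k hmin)
    (le_sandwichPNega p e (fun j => IsLocalRing.maximalIdeal (MvPowerSeries (Fin 1) K) ^ j) (m := p ^ e) (a := a) (d := k)
      ha (Nat.mul_ne_zero hk.ne' (pow_prime_ne_zero p e)))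

/-! ## §3 The completion datum `φ : K[x] → K⟦x⟧` and the cell F4 -/

/-- `φ(x^n) = x^n`. [folklore] -/
theorem coeToMvPowerSeries_X_pow (n : ℕ) :
    MvPolynomial.coeToMvPowerSeries.ringHom ((X 0 : MvPolynomial (Fin 1) K) ^ n) =
      (MvPowerSeries.X 0 : MvPowerSeries (Fin 1) K) ^ n := by
  rw [map_pow]
  exact congrArg (· ^ n) (MvPolynomial.coe_X 0)

/-- `φ((x)^n) ⊆ 𝔪′^n`: the completion map sends `(x^n)·K[x]` into `(x^n)·K⟦x⟧`. [folklore] -/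
theorem map_idealOfVars_pow_le (n : ℕ) :
    (idealOfVars (Fin 1) K ^ n).map (MvPolynomial.coeToMvPowerSeries.ringHom) ≤
      IsLocalRing.maximalIdeal (MvPowerSeries (Fin 1) K) ^ n := by
  rw [idealOfVars_fin_one_pow, Ideal.map_span, Set.image_singleton, coeToMvPowerSeries_X_pow,
    maximalIdeal_pow_eq_span_psX_pow]

/-- **F4, first inclusion (`baseChange_mem` shape) × SW = ✓ at the completion datum:** for every degree `−a` and every
`f ∈ ℘nega_sw(E,−a) ⊆ K[x]`, `φ f ∈ ℘nega_sw′(E,−a) ⊆ K⟦x⟧` (both sides are `(x)^{k(a)·p^e}`). [folklore] -/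
theorem F4_baseChange_mem_sandwich_affineLine [CharP (MvPowerSeries (Fin 1) K) p] (e : ℕ) :
    ∀ (a : ℕ) (f : MvPolynomial (Fin 1) K),
      f ∈ sandwichPNega p e (fun j => idealOfVars (Fin 1) K ^ j) (p ^ e) a →
        MvPolynomial.coeToMvPowerSeries.ringHom f ∈
          sandwichPNega p e (fun j => IsLocalRing.maximalIdeal (MvPowerSeries (Fin 1) K) ^ j) (p ^ e) a := by
  intro a f hf
  obtain ⟨k, hk, ha, hmin⟩ := exists_least_admissible (p ^ e) (Nat.pos_of_ne_zero (pow_prime_ne_zero p e)) a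
  rw [sandwichPNega_affineLine_eq K p e a k hk ha hmin] at hf
  rw [sandwichPNega_powerSeriesLine_eq K p e a k hk ha hmin]
  exact map_idealOfVars_pow_le K _ (Ideal.mem_map_of_mem _ hf)

/-- **F4, second inclusion (`baseChange_le` shape) × SW = ✓ at the completion datum:** `℘nega_sw′(E,−a) ⊆ φ(℘nega_sw(E,−a))·K⟦x⟧`
(the generator `x^{k(a)·p^e}` of the left side is the image of an element of the right side). [folklore] -/
theorem F4_baseChange_le_sandwich_affineLine [CharP (MvPowerSeries (Fin 1) K) p] (e : ℕ) :
    ∀ a : ℕ,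
      (sandwichPNega p e (fun j => IsLocalRing.maximalIdeal (MvPowerSeries (Fin 1) K) ^ j) (p ^ e) a :
          Set (MvPowerSeries (Fin 1) K)) ⊆
        (Ideal.span (MvPolynomial.coeToMvPowerSeries.ringHom ''
            (sandwichPNega p e (fun j => idealOfVars (Fin 1) K ^ j) (p ^ e) a : Set (MvPolynomial (Fin 1) K))) :
          Set (MvPowerSeries (Fin 1) K)) := by
  intro a
  obtain ⟨k, hk, ha, hmin⟩ := exists_least_admissible (p ^ e) (Nat.pos_of_ne_zero (pow_prime_ne_zero p e)) a
  rw [sandwichPNega_powerSeriesLine_eq K p e a k hk ha hmin, sandwichPNega_affineLine_eq K p e a k hk ha hmin,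
    maximalIdeal_pow_eq_span_psX_pow, SetLike.coe_subset_coe, Ideal.span_le, Set.singleton_subset_iff]
  refine Ideal.subset_span ⟨(X 0 : MvPolynomial (Fin 1) K) ^ (k * p ^ e), ?_, coeToMvPowerSeries_X_pow K _⟩
  rw [SetLike.mem_coe, X_pow_mem_idealOfVars_pow_iff]

/-- **F4 × PW (both inclusions) = ✓ at the completion datum** (res-type-087's `Campaign.PowerWitness.negPiece`, p492701):
`φ(PW(−a)) ⊆ PW′(−a)` (ring maps commute with `ρ^e`) and `PW′(−a) ⊆ φ(PW(−a))·K⟦x⟧` (`PW′(−a) ∋ z = w^{p^e}`, `w = x^{kp^e}·u`, so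
`z = φ((x^{kp^e})^{p^e})·u^{p^e}`). [folklore] -/
theorem F4_baseChange_powerWitness_affineLine [CharP (MvPowerSeries (Fin 1) K) p] (e : ℕ) :
    (∀ (a : ℕ) (y : MvPolynomial (Fin 1) K),
      y ∈ PowerWitness.negPiece p e (fun j => idealOfVars (Fin 1) K ^ j) (p ^ e) a →
        MvPolynomial.coeToMvPowerSeries.ringHom y ∈
          PowerWitness.negPiece p e (fun j => IsLocalRing.maximalIdeal (MvPowerSeries (Fin 1) K) ^ j) (p ^ e) a) ∧
    ∀ a : ℕ,
      (PowerWitness.negPiece p e (fun j => IsLocalRing.maximalIdeal (MvPowerSeries (Fin 1) K) ^ j) (p ^ e) a :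
          Set (MvPowerSeries (Fin 1) K)) ⊆
        (Ideal.span (MvPolynomial.coeToMvPowerSeries.ringHom ''
            (PowerWitness.negPiece p e (fun j => idealOfVars (Fin 1) K ^ j) (p ^ e) a : Set (MvPolynomial (Fin 1) K))) :
          Set (MvPowerSeries (Fin 1) K)) := by
  refine ⟨fun a y hy => ?_, fun a => ?_⟩
  · obtain ⟨x, hx, rfl⟩ := PowerWitness.mem_negPiece_iff.mp hy
    rw [map_pow]
    exact PowerWitness.pow_mem_negPiece (F4_baseChange_mem_sandwich_affineLine K p e a x hx)
  · obtain ⟨k, hk, ha, hmin⟩ := exists_least_admissible (p ^ e) (Nat.pos_of_ne_zero (pow_prime_ne_zero p e)) a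
    intro z hz
    obtain ⟨w, hw, rfl⟩ := PowerWitness.mem_negPiece_iff.mp hz
    rw [sandwichPNega_powerSeriesLine_eq K p e a k hk ha hmin, maximalIdeal_pow_eq_span_psX_pow,
      Ideal.mem_span_singleton] at hw
    obtain ⟨u, rfl⟩ := hw
    rw [SetLike.mem_coe, mul_pow]
    refine Ideal.mul_mem_right _ _ (Ideal.subset_span ⟨((X 0 : MvPolynomial (Fin 1) K) ^ (k * p ^ e)) ^ p ^ e, ?_, ?_⟩)
    · rw [SetLike.mem_coe]
      refine PowerWitness.pow_mem_negPiece ?_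
      rw [sandwichPNega_affineLine_eq K p e a k hk ha hmin, X_pow_mem_idealOfVars_pow_iff]
    · rw [map_pow, coeToMvPowerSeries_X_pow]

end PowerSeriesLine

end Summit.ResolutionOfSingularities.ResolutionOfSingularities.Theorems.Campaign.W12

end
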